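import Summits.QuantumAdvantage.QuantumAdvantage.Theorems.InnerDegreeLawsA

set_option linter.dupNamespace false
set_option linter.unusedSectionVars false

/-!
# FormTableA (lens 4, g29; (P8) ⟹ (P1) of the (c0) road, algebra half) — a quadratic value whose symmetrised matrix is LOW RANK OFF FEW LINES is a function of FEW LINEAR FORMS

Blocker `X = AbsorptionDial.NoPerfectPolyOdd` (item 28487); decomp-qadv lens 4, g29.  Pure algebra over `ZMod p`, `p` odd.

* `ind`, `quadVal_ind` (the quadratic value in indicator form);
* `quadVal_fill` — GENERAL restriction to a subcube: `quadVal M b (fill ρ T v) = quadVal M_T b_T v + C` with `M_T j j' = M (T j) (T j')`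
  (the tree's `quadVal_fill_affine` is the case `M_T = 0`);
* ★ `quadVal_table` — if `M i j + M j i = (A * B) i j` for all `i ≠ j` outside an exceptional set `Z` (`A : n × r`, `B : r × n`), then
  `quadVal M b u = 2⁻¹·(Σ_t (A-column form)·(B-row form) + Σ_{z ∈ Z} u_z · (z-th line form)) + (diagonal form)`, an explicit function of
  `2r + 2|Z| + 1` linear forms of `u`;
* ★★ `quadVal_formTable` — the same packaged over `Fin (2r + 2|Z| + 1)`: `∃ ℓ G, ∀ u, quadVal M b u = G (fun t => Σ_i [u i] ℓ t i)` — the input format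
  of LAW C (`InnerDegreeLawsA.loss_on_kForm_subcube`).

With `InnerDegreeLawsK.offDiag_lowRank_finset` ((P8): `Q = R` off `≤ 2r₀` lines, `rank R ≤ r₀`) and `BlockRankA.exists_factor` (`R = A * B` through `Fin R.rank`)
this is (P8) ⟹ (P1).  Supports stmt-QuantumAdvantage-28487 (record; the residual `X` is NOT claimed).
-/

open Finset
open Summit.QuantumAdvantage.QuantumAdvantage.Theorems.InnerDegreeDial

namespace Summit.QuantumAdvantage.QuantumAdvantage.Theorems.FormTable

variable {p : ℕ} [Fact p.Prime] {n m : ℕ}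

/-! ### 1. Indicator form and general subcube restriction -/

/-- the `ZMod p`-valued indicator of a Boolean point -/
def ind (u : Fin n → Bool) (i : Fin n) : ZMod p := if u i = true then 1 else 0

/-- `[u i]·x` -/
theorem ite_eq_ind_mul (u : Fin n → Bool) (i : Fin n) (x : ZMod p) : (if u i = true then x else 0) = ind u i * x := by
  unfold ind
  split_ifs <;> simp

/-- indicators are idempotent -/
theorem ind_mul_self (u : Fin n → Bool) (i : Fin n) : ind (p := p) u i * ind u i = ind u i := by
  unfold ind
  split_ifs <;> simp

/-- the quadratic value in indicator form -/
theorem quadVal_ind (M : Fin n → Fin n → ZMod p) (b : Fin n → ZMod p) (u : Fin n → Bool) :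
    quadVal M b u = (∑ i, ∑ i', ind u i * (ind u i' * M i i')) + ∑ i, ind u i * b i := by
  unfold quadVal
  congr 1
  · refine sum_congr rfl fun i _ => sum_congr rfl fun i' _ => ?_
    rw [ite_eq_ind_mul, ite_eq_ind_mul]
  · exact sum_congr rfl fun i _ => ite_eq_ind_mul u i (b i)

/-- on the subcube, the indicator of a free coordinate is the free indicator -/
theorem ind_fill_app (ρ : Fin n → Bool) (T : Fin m ↪ Fin n) (v : Fin m → Bool) (j : Fin m) :
    ind (p := p) (fill ρ T v) (T j) = ind v j := by
  unfold ind
  rw [fill_app]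

/-- on the subcube, the indicator of a frozen coordinate is the frozen indicator -/
theorem ind_fill_off (ρ : Fin n → Bool) (T : Fin m ↪ Fin n) (v : Fin m → Bool) {i : Fin n} (hi : i ∈ (univ.map T)ᶜ) :
    ind (p := p) (fill ρ T v) i = ind ρ i := by
  unfold ind
  rw [fill_of_not_mem ρ T v (mem_compl.mp hi)]

/-- **general restriction of a quadratic value to a subcube**: `quadVal M b (fill ρ T v) = quadVal M_T b_T v + C`. -/
theorem quadVal_fill (M : Fin n → Fin n → ZMod p) (b : Fin n → ZMod p) (ρ : Fin n → Bool) (T : Fin m ↪ Fin n) :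
    ∃ C : ZMod p, ∀ v, quadVal M b (fill ρ T v)
      = quadVal (fun j j' => M (T j) (T j'))
          (fun j => b (T j) + ∑ i' ∈ (univ.map T)ᶜ, ind ρ i' * (M (T j) i' + M i' (T j))) v + C := by
  classical
  refine ⟨(∑ i ∈ (univ.map T)ᶜ, ∑ i' ∈ (univ.map T)ᶜ, ind ρ i * (ind ρ i' * M i i')) + ∑ i ∈ (univ.map T)ᶜ, ind ρ i * b i,
    fun v => ?_⟩
  rw [quadVal_ind, quadVal_ind]
  set a : Fin n → ZMod p := ind (fill ρ T v) with ha
  have ha1 : ∀ j, a (T j) = ind v j := fun j => ind_fill_app ρ T v j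
  have ha2 : ∀ i ∈ (univ.map T)ᶜ, a i = ind ρ i := fun i hi => ind_fill_off ρ T v hi
  -- the double sum, split four ways
  have hQ : (∑ i, ∑ i', a i * (a i' * M i i'))
      = (∑ j, ∑ j', ind v j * (ind v j' * M (T j) (T j')))
        + (∑ j, ind v j * ∑ i' ∈ (univ.map T)ᶜ, ind ρ i' * M (T j) i')
        + (∑ j, ind v j * ∑ i ∈ (univ.map T)ᶜ, ind ρ i * M i (T j))
        + ∑ i ∈ (univ.map T)ᶜ, ∑ i' ∈ (univ.map T)ᶜ, ind ρ i * (ind ρ i' * M i i') := by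
    rw [sum_split T]
    have hin : ∀ i, (∑ i', a i * (a i' * M i i'))
        = (∑ j', a i * (ind v j' * M i (T j'))) + ∑ i' ∈ (univ.map T)ᶜ, a i * (ind ρ i' * M i i') := by
      intro i
      rw [sum_split T]
      congr 1
      · exact sum_congr rfl fun j' _ => by rw [ha1]
      · exact sum_congr rfl fun i' hi' => by rw [ha2 i' hi']
    simp_rw [hin]
    rw [sum_add_distrib, sum_add_distrib]
    have e1 : (∑ j, ∑ j', a (T j) * (ind v j' * M (T j) (T j'))) = ∑ j, ∑ j', ind v j * (ind v j' * M (T j) (T j')) :=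
      sum_congr rfl fun j _ => by rw [ha1]
    have e2 : (∑ j, ∑ i' ∈ (univ.map T)ᶜ, a (T j) * (ind ρ i' * M (T j) i'))
        = ∑ j, ind v j * ∑ i' ∈ (univ.map T)ᶜ, ind ρ i' * M (T j) i' :=
      sum_congr rfl fun j _ => by rw [ha1, mul_sum]
    have e3 : (∑ i ∈ (univ.map T)ᶜ, ∑ j', a i * (ind v j' * M i (T j')))
        = ∑ j, ind v j * ∑ i ∈ (univ.map T)ᶜ, ind ρ i * M i (T j) := by
      rw [sum_comm]
      refine sum_congr rfl fun j' _ => ?_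
      rw [mul_sum]
      refine sum_congr rfl fun i hi => ?_
      rw [ha2 i hi]
      ring
    have e4 : (∑ i ∈ (univ.map T)ᶜ, ∑ i' ∈ (univ.map T)ᶜ, a i * (ind ρ i' * M i i'))
        = ∑ i ∈ (univ.map T)ᶜ, ∑ i' ∈ (univ.map T)ᶜ, ind ρ i * (ind ρ i' * M i i') :=
      sum_congr rfl fun i hi => by rw [ha2 i hi]
    rw [e1, e2, e3, e4]
    ring
  -- the linear part, split two ways
  have hL : (∑ i, a i * b i) = (∑ j, ind v j * b (T j)) + ∑ i ∈ (univ.map T)ᶜ, ind ρ i * b i := by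
    rw [sum_split T]
    congr 1
    · exact sum_congr rfl fun j _ => by rw [ha1]
    · exact sum_congr rfl fun i hi => by rw [ha2 i hi]
  -- the new linear part expands
  have hR : (∑ j, ind v j * (b (T j) + ∑ i' ∈ (univ.map T)ᶜ, ind ρ i' * (M (T j) i' + M i' (T j))))
      = (∑ j, ind v j * b (T j)) + (∑ j, ind v j * ∑ i' ∈ (univ.map T)ᶜ, ind ρ i' * M (T j) i')
        + ∑ j, ind v j * ∑ i ∈ (univ.map T)ᶜ, ind ρ i * M i (T j) := by
    rw [← sum_add_distrib, ← sum_add_distrib]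
    refine sum_congr rfl fun j _ => ?_
    rw [show (∑ i' ∈ (univ.map T)ᶜ, ind ρ i' * (M (T j) i' + M i' (T j)))
        = (∑ i' ∈ (univ.map T)ᶜ, ind ρ i' * M (T j) i') + ∑ i ∈ (univ.map T)ᶜ, ind ρ i * M i (T j) by
      rw [← sum_add_distrib]; exact sum_congr rfl fun _ _ => by ring]
    ring
  rw [hQ, hL, hR]
  ring

/-! ### 2. The form table -/

/-- the `ZMod p`-valued indicator of the exceptional set -/
def zind (Z : Finset (Fin n)) (i : Fin n) : ZMod p := if i ∈ Z then 1 else 0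

/-- `Σ_i [i ∈ Z]·h i = Σ_{z ∈ Z} h z` -/
theorem sum_zind_mul (Z : Finset (Fin n)) (h : Fin n → ZMod p) : ∑ i, zind Z i * h i = ∑ z : ↥Z, h z := by
  classical
  unfold zind
  simp_rw [ite_mul, one_mul, zero_mul]
  rw [sum_ite_mem_eq, sum_coe_sort]

/-- **THE FORM TABLE (explicit).**  With `D i j := M i j + M j i − (A B) i j` (vanishing off the diagonal outside `Z`):
`quadVal M b u = 2⁻¹·( Σ_t (Σ_i [u i] A i t)(Σ_i [u i] B t i) + Σ_{z ∈ Z} [u z]·(Σ_i [u i] (D z i + [i ∉ Z] D i z)) ) + Σ_i [u i]([i ∉ Z]·2⁻¹ D i i + b i)`. -/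
theorem quadVal_table (h2 : (2 : ZMod p) ≠ 0) (M : Fin n → Fin n → ZMod p) (b : Fin n → ZMod p) (Z : Finset (Fin n)) {r : ℕ}
    (A : Matrix (Fin n) (Fin r) (ZMod p)) (B : Matrix (Fin r) (Fin n) (ZMod p))
    (hR : ∀ i j, i ≠ j → i ∉ Z → j ∉ Z → M i j + M j i = (A * B) i j) (u : Fin n → Bool) :
    quadVal M b u
      = 2⁻¹ * ((∑ t, (∑ i, ind u i * A i t) * (∑ i, ind u i * B t i))
          + ∑ z : ↥Z, ind u z * ∑ i, ind u i * ((M z i + M i z - (A * B) z i) + (1 - zind Z i) * (M i z + M z i - (A * B) i z)))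
        + ∑ i, ind u i * ((1 - zind Z i) * (2⁻¹ * (M i i + M i i - (A * B) i i)) + b i) := by
  classical
  set D : Fin n → Fin n → ZMod p := fun i j => M i j + M j i - (A * B) i j with hD
  have hD0 : ∀ i j, i ≠ j → i ∉ Z → j ∉ Z → D i j = 0 := by
    intro i j hij hi hj
    simp only [hD, hR i j hij hi hj, sub_self]
  rw [quadVal_ind]
  -- (A) symmetrisation
  have hsym : (∑ i, ∑ i', ind u i * (ind u i' * M i' i)) = ∑ i, ∑ i', ind u i * (ind u i' * M i i') := by
    rw [sum_comm]
    exact sum_congr rfl fun _ _ => sum_congr rfl fun _ _ => by ring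
  have hA : (∑ i, ∑ i', ind u i * (ind u i' * M i i'))
      = 2⁻¹ * ∑ i, ∑ i', ind u i * (ind u i' * (M i i' + M i' i)) := by
    have h2s : (∑ i, ∑ i', ind u i * (ind u i' * (M i i' + M i' i))) = 2 * ∑ i, ∑ i', ind u i * (ind u i' * M i i') := by
      have : (∑ i, ∑ i', ind u i * (ind u i' * (M i i' + M i' i)))
          = (∑ i, ∑ i', ind u i * (ind u i' * M i i')) + ∑ i, ∑ i', ind u i * (ind u i' * M i' i) := by
        rw [← sum_add_distrib]
        refine sum_congr rfl fun i _ => ?_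
        rw [← sum_add_distrib]
        exact sum_congr rfl fun i' _ => by ring
      rw [this, hsym]
      ring
    rw [h2s, ← mul_assoc, inv_mul_cancel₀ h2, one_mul]
  -- (B) `M + Mᵀ = A B + D`
  have hB : (∑ i, ∑ i', ind u i * (ind u i' * (M i i' + M i' i)))
      = (∑ i, ∑ i', ind u i * (ind u i' * (A * B) i i')) + ∑ i, ∑ i', ind u i * (ind u i' * D i i') := by
    rw [← sum_add_distrib]
    refine sum_congr rfl fun i _ => ?_
    rw [← sum_add_distrib]
    refine sum_congr rfl fun i' _ => ?_
    simp only [hD]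
    ring
  -- (C) the low-rank part = `r` products of forms
  have hC : (∑ i, ∑ i', ind u i * (ind u i' * (A * B) i i')) = ∑ t, (∑ i, ind u i * A i t) * (∑ i, ind u i * B t i) := by
    have step : ∀ i i', ind u i * (ind u i' * (A * B) i i') = ∑ t, (ind u i * A i t) * (ind u i' * B t i') := by
      intro i i'
      rw [Matrix.mul_apply, mul_sum, mul_sum]
      exact sum_congr rfl fun t _ => by ring
    simp_rw [step]
    calc (∑ i, ∑ i', ∑ t, ind u i * A i t * (ind u i' * B t i'))
        = ∑ i, ∑ t, ∑ i', ind u i * A i t * (ind u i' * B t i') := sum_congr rfl fun i _ => sum_comm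
      _ = ∑ t, ∑ i, ∑ i', ind u i * A i t * (ind u i' * B t i') := sum_comm
      _ = ∑ t, (∑ i, ind u i * A i t) * (∑ i, ind u i * B t i) := sum_congr rfl fun t _ => by rw [sum_mul_sum]
  -- (D) the exceptional part = diagonal form + one product per exceptional line
  have hDsplit : ∀ i i', ind u i * (ind u i' * D i i')
      = zind Z i * (ind u i * (ind u i' * D i i'))
        + zind Z i' * (ind u i' * ((1 - zind Z i) * (ind u i * D i i')))
        + (1 - zind Z i) * (1 - zind Z i') * (ind u i * (ind u i' * D i i')) := by
    intro i i'
    ring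
  have hdiag : ∀ i, (∑ i', (1 - zind Z i) * (1 - zind Z i') * (ind u i * (ind u i' * D i i')))
      = (1 - zind Z i) * (ind u i * D i i) := by
    intro i
    rw [sum_eq_single i]
    · have hz : (1 - zind (p := p) Z i) * (1 - zind Z i) = 1 - zind Z i := by
        unfold zind; split_ifs <;> ring
      calc (1 - zind Z i) * (1 - zind Z i) * (ind u i * (ind u i * D i i))
          = ((1 - zind Z i) * (1 - zind Z i)) * ((ind u i * ind u i) * D i i) := by ring
        _ = (1 - zind Z i) * (ind u i * D i i) := by rw [hz, ind_mul_self]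
    · intro i' _ hi'
      by_cases hi : i ∈ Z
      · have hz : zind (p := p) Z i = 1 := by unfold zind; rw [if_pos hi]
        rw [hz]; ring
      by_cases hi'Z : i' ∈ Z
      · have hz : zind (p := p) Z i' = 1 := by unfold zind; rw [if_pos hi'Z]
        rw [hz]; ring
      rw [hD0 i i' (Ne.symm hi') hi hi'Z]
      ring
    · intro h
      exact (h (mem_univ _)).elim
  have hDD : (∑ i, ∑ i', ind u i * (ind u i' * D i i'))
      = (∑ z : ↥Z, ind u z * ∑ i, ind u i * (D z i + (1 - zind Z i) * D i z))
        + ∑ i, (1 - zind Z i) * (ind u i * D i i) := by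
    rw [show (∑ i, ∑ i', ind u i * (ind u i' * D i i'))
        = ∑ i, ∑ i', (zind Z i * (ind u i * (ind u i' * D i i'))
          + zind Z i' * (ind u i' * ((1 - zind Z i) * (ind u i * D i i')))
          + (1 - zind Z i) * (1 - zind Z i') * (ind u i * (ind u i' * D i i'))) from
      sum_congr rfl fun i _ => sum_congr rfl fun i' _ => hDsplit i i']
    simp_rw [sum_add_distrib]
    simp_rw [hdiag]
    congr 1
    -- the two exceptional sums
    have t1 : (∑ i, ∑ i', zind Z i * (ind u i * (ind u i' * D i i')))
        = ∑ z : ↥Z, ind u z * ∑ i', ind u i' * D z i' := by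
      calc (∑ i, ∑ i', zind Z i * (ind u i * (ind u i' * D i i')))
          = ∑ i, zind Z i * (ind u i * ∑ i', ind u i' * D i i') :=
            sum_congr rfl fun i _ => by rw [mul_sum, mul_sum]
        _ = _ := sum_zind_mul Z _
    have t2 : (∑ i, ∑ i', zind Z i' * (ind u i' * ((1 - zind Z i) * (ind u i * D i i'))))
        = ∑ z : ↥Z, ind u z * ∑ i, ind u i * ((1 - zind Z i) * D i z) := by
      rw [sum_comm]
      calc (∑ i', ∑ i, zind Z i' * (ind u i' * ((1 - zind Z i) * (ind u i * D i i'))))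
          = ∑ i', zind Z i' * (ind u i' * ∑ i, ind u i * ((1 - zind Z i) * D i i')) :=
            sum_congr rfl fun i' _ => by
              rw [mul_sum, mul_sum]
              exact sum_congr rfl fun i _ => by ring
        _ = _ := sum_zind_mul Z _
    rw [t1, t2, ← sum_add_distrib]
    refine sum_congr rfl fun z _ => ?_
    rw [← mul_add, ← sum_add_distrib]
    congr 1
    exact sum_congr rfl fun i _ => by ring
  -- assemble
  rw [hA, hB, hC, hDD]
  have hlin : (∑ i, ind u i * ((1 - zind Z i) * (2⁻¹ * (M i i + M i i - (A * B) i i)) + b i))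
      = 2⁻¹ * (∑ i, (1 - zind Z i) * (ind u i * D i i)) + ∑ i, ind u i * b i := by
    rw [mul_sum, ← sum_add_distrib]
    refine sum_congr rfl fun i _ => ?_
    simp only [hD]
    ring
  rw [hlin]
  ring

/-- the index of the form table: `r` column forms, `r` row forms, per exceptional line its coordinate and its line form, one diagonal form -/
abbrev TableIx (r : ℕ) (Z : Finset (Fin n)) : Type := ((Fin r ⊕ Fin r) ⊕ (↥Z × Bool)) ⊕ Unit

/-- the table has `2r + 2|Z| + 1` entries -/
theorem card_tableIx (r : ℕ) (Z : Finset (Fin n)) : Fintype.card (TableIx r Z) = 2 * r + 2 * Z.card + 1 := by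
  simp only [TableIx, Fintype.card_sum, Fintype.card_fin, Fintype.card_prod, Fintype.card_coe, Fintype.card_bool,
    Fintype.card_unit]
  ring

/-- the forms of the table -/
def tableForm (M : Fin n → Fin n → ZMod p) (b : Fin n → ZMod p) (Z : Finset (Fin n)) {r : ℕ}
    (A : Matrix (Fin n) (Fin r) (ZMod p)) (B : Matrix (Fin r) (Fin n) (ZMod p)) : TableIx r Z → Fin n → ZMod p
  | Sum.inl (Sum.inl (Sum.inl t)) => fun i => A i t
  | Sum.inl (Sum.inl (Sum.inr t)) => fun i => B t i
  | Sum.inl (Sum.inr (z, false)) => fun i => if i = z.1 then 1 else 0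
  | Sum.inl (Sum.inr (z, true)) => fun i => (M z i + M i z - (A * B) z i) + (1 - zind Z i) * (M i z + M z i - (A * B) i z)
  | Sum.inr () => fun i => (1 - zind Z i) * (2⁻¹ * (M i i + M i i - (A * B) i i)) + b i

/-- the evaluation map of the table -/
def tableEval (Z : Finset (Fin n)) (r : ℕ) (w : TableIx r Z → ZMod p) : ZMod p :=
  2⁻¹ * ((∑ t : Fin r, w (Sum.inl (Sum.inl (Sum.inl t))) * w (Sum.inl (Sum.inl (Sum.inr t))))
      + ∑ z : ↥Z, w (Sum.inl (Sum.inr (z, false))) * w (Sum.inl (Sum.inr (z, true))))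
    + w (Sum.inr ())

/-- the coordinate form evaluates to the indicator -/
theorem sum_ind_mul_ite_eq (u : Fin n → Bool) (z : Fin n) : (∑ i, ind (p := p) u i * (if i = z then 1 else 0)) = ind u z := by
  simp_rw [mul_ite, mul_one, mul_zero]
  rw [sum_ite_eq' univ z]
  simp

/-- **THE FORM TABLE over its natural index**: `quadVal M b u = tableEval (fun x => Σ_i [u i]·tableForm x i)`. -/
theorem quadVal_tableEval (h2 : (2 : ZMod p) ≠ 0) (M : Fin n → Fin n → ZMod p) (b : Fin n → ZMod p) (Z : Finset (Fin n)) {r : ℕ}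
    (A : Matrix (Fin n) (Fin r) (ZMod p)) (B : Matrix (Fin r) (Fin n) (ZMod p))
    (hR : ∀ i j, i ≠ j → i ∉ Z → j ∉ Z → M i j + M j i = (A * B) i j) (u : Fin n → Bool) :
    quadVal M b u = tableEval Z r (fun x => ∑ i, ind u i * tableForm M b Z A B x i) := by
  rw [quadVal_table h2 M b Z A B hR u]
  unfold tableEval
  simp only [tableForm, sum_ind_mul_ite_eq]

/-- **THE FORM TABLE in LAW C's format**: `2r + 2|Z| + 1` linear forms `ℓ` and a map `G` with `quadVal M b u = G (fun t => Σ_i [u i] ℓ t i)`. -/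
theorem quadVal_formTable (h2 : (2 : ZMod p) ≠ 0) (M : Fin n → Fin n → ZMod p) (b : Fin n → ZMod p) (Z : Finset (Fin n)) {r : ℕ}
    (A : Matrix (Fin n) (Fin r) (ZMod p)) (B : Matrix (Fin r) (Fin n) (ZMod p))
    (hR : ∀ i j, i ≠ j → i ∉ Z → j ∉ Z → M i j + M j i = (A * B) i j) :
    ∃ (ℓ : Fin (2 * r + 2 * Z.card + 1) → Fin n → ZMod p) (G : (Fin (2 * r + 2 * Z.card + 1) → ZMod p) → ZMod p),
      ∀ u, quadVal M b u = G (fun t => ∑ i, if u i = true then ℓ t i else 0) := by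
  classical
  let e : TableIx r Z ≃ Fin (2 * r + 2 * Z.card + 1) := (Fintype.equivFin (TableIx r Z)).trans (finCongr (card_tableIx r Z))
  refine ⟨fun t => tableForm M b Z A B (e.symm t), fun vals => tableEval Z r (fun x => vals (e x)), fun u => ?_⟩
  rw [quadVal_tableEval h2 M b Z A B hR u]
  congr 1
  funext x
  simp only [Equiv.symm_apply_apply]
  exact sum_congr rfl fun i _ => (ite_eq_ind_mul u i _).symm

end Summit.QuantumAdvantage.QuantumAdvantage.Theorems.FormTable
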